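import Literature.IUT.HodgeTheaters.KitCoreBridge
import HarnessLib

/-!
# [IUTchI] Proposition 6.7 for kits of a §4 datum: the output of the algorithm `Θ^±-bridge ↦ Θ-bridge`
# IS a `𝒟-Θ`-bridge in the sense of abc-iut-L5-t3's Definition 4.6 (ii), read through `KitCore(K, 𝔡)`
# (sub-DAG row P67-L05; proof-only)

S. Mochizuki, *Inter-universal Teichmüller theory I*, kurims manuscript (May 2020), §6 Proposition 6.7 p. 167
("we obtain a functorial algorithm for constructing a [well-defined, up to a unique isomorphism!]
`𝒟-Θ`-bridge `†φ^Θ_⋇ : †𝔇_{T^⋇} → †𝔇_>` as in Definition 4.6, (ii)"), §4 Definition 4.6 (ii) p. 111 ("such that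
there exist isomorphisms `𝔇_> ⥲ †𝔇_>`, `𝔇_⋇ ⥲ †𝔇_J`, conjugation by which maps `φ^Θ_⋇ ↦ †φ^Θ_⋇`"), Example 4.4
(ii)–(iv) p. 107, Proposition 4.8 (ii) p. 115 ([IUTchI] Prop 6.7 p.167) [claim: Mochizuki2012, status: disputed]
(D-0012 claim key, series status DISPUTED — label / poly-morphism bookkeeping between two landed typings
of the cell; nothing of the series is asserted, no side is taken on [IUTchIII] Cor. 3.12).

PROOF-ONLY sequel to `KitCoreBridge.lean` (abc-iut-L5-t3 g3: the §4 ↔ §6 base-kit dictionary `KitCore(K, 𝔡)`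
and the printed identification `ThetaAgrees` of the kit's Example-4.4 poly-morphisms with abc-iut-L5-t3's
`phiThetaAt`).  Sub-DAG `plan/L5/SUBDAG-IUTchI-Prop67-Prop68i.md` (abc-iut-w5-d228) left ONE row after its
kit-level files: **P67-L05** — instantiate abc-iut-w4-d054's inhabitant `thetaBridgeAlgorithm_isModelConjugate`
(`PMBaseThetaBridgeProofs.lean`, conditional on the printed bi-invariance `hbad` of `φ^Θ_{v_j}`) at
abc-iut-L5-t3's ACTUAL Definition 4.6 (ii) shape through the dictionary.  Proved here, for every base kit
that core-agrees with a §4 datum (`c : KitCore 𝔡 K`, `c.ThetaAgrees M`):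

* `KitCore.thetaBridgeAlgorithm_isModelConjugate` — w4-d054's kit-level Def 4.6 (ii) statement
  `ThetaBridgeAlgorithm M (isModelConjugate) hl`, its hypothesis `hbad` DISCHARGED by
  `KitCore.thetaPolyBad_biSaturated` (Ex 4.4 (ii) "composing with arbitrary isomorphisms", from
  `BaseThetaDatum.isEvalSection_isoComp/_compIso`);
* `KitCore.transport_phiThetaAt_of_not_bad` — at `v ∈ 𝕍^good` the transport of abc-iut-L5-t3's `φ^Θ_{v_j}`
  (Ex 4.4 (iii): "the full poly-isomorphism") is the kit's full poly-isomorphism of the model;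
* **`KitCore.thetaBridgeData_isModel`** (P67-L05) — for every `𝒟-Θ^±`-bridge `B`, the output
  `B.thetaBridgeData M hl` satisfies abc-iut-L5-t3's `BaseThetaDatum.DThetaBridge.isModel` clause
  (`BaseHodgeTheaters.lean`) VERBATIM IN SHAPE — "there exist `ι : 𝔽_l^⋇ ⥲ J`, isomorphisms `κ_j : 𝔇_j ⥲ †𝔇_j`,
  `γ : 𝔇_> ⥲ †𝔇_>` such that `†φ^Θ_{ι(j),v} = γ ∘ φ^Θ_{v_j} ∘ κ_j⁻¹`" — with abc-iut-L5-t3's model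
  poly-morphism `BaseThetaDatum.modelThetaBridge j v` (Example 4.4 (iv)) read in the kit through the
  dictionary (transported along the fully faithful comparison functor and the model identification); at
  every place of the kit, bad or good;
* `KitCore.card_thetaBridgeData_hom` — Prop 4.8 (ii) on the outputs: "the set of isomorphisms between two
  `𝒟-Θ`-bridges is of cardinality one" (abc-iut-w5-d228's existence + `KitCore.thetaBridgeData_hom_subsingleton`).

No `def`, no new `Prop` fact; the `𝒟-Θ`-bridge of abc-iut-L5-t3's file itself (an object indexed by ALL of
`𝕍`) is not constructed here — a kit may be indexed by a truncation of `𝕍` (merge canon D13), so the faithful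
statement is the `isModel` clause place by place over the kit's index set, as above.  typed ≠ proved
elsewhere; every `theorem` here is kernel-checked.
-/

namespace Literature.IUT.HodgeTheaters

open CategoryTheory

universe u

namespace BaseThetaDatum.KitCore

variable {𝔡 : BaseThetaDatum.{u}} {K : PMBaseKit.{u} 𝔡.l} (c : 𝔡.KitCore K) {M : K.MultKit}

/-- Automorphisms of the kit's model are exactly the transports of automorphisms of `𝒟_v` (the comparison
functor is fully faithful, hence preserves and reflects isomorphisms): at a GOOD place the transport of
abc-iut-L5-t3's `φ^Θ_{v_j}` — "the full poly-isomorphism" of [IUTchI] Example 4.4 (iii) — is the kit's full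
poly-isomorphism `{θ | θ : 𝒟_v ⥲ 𝒟_v}` of the model. ([IUTchI] Ex 4.4 (iii) p.107) [claim: Mochizuki2012, status: disputed] -/
theorem transport_phiThetaAt_of_not_bad (x : K.V) (hx : x ∉ K.bad) (j : FlStar 𝔡.l) :
    {g : K.model x ⟶ K.model x | ∃ f ∈ 𝔡.phiThetaAt j (c.e x) (𝔡.D (c.e x)) (𝔡.D (c.e x)),
        g = (c.ambModel x).inv ≫ (c.amb x).map f ≫ (c.ambModel x).hom} =
      {g | ∃ θ : K.model x ≅ K.model x, g = θ.hom} := by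
  have hv : ¬ 𝔡.IsBad (c.e x) := fun h => hx ((c.mem_bad_iff x).2 h)
  rw [phiThetaAt_of_not_isBad j hv]
  ext g
  constructor
  · rintro ⟨f, hf, rfl⟩
    haveI : IsIso f := hf
    exact ⟨(c.ambModel x).symm ≪≫ (c.amb x).mapIso (asIso f) ≪≫ c.ambModel x, by simp⟩
  · rintro ⟨θ, rfl⟩
    refine ⟨(c.isoPreimage x θ).hom, Iso.isIso_hom _, ?_⟩
    rw [c.map_isoPreimage_hom]
    simp

variable {c}

/-- **[IUTchI] Prop 6.7, Def 4.6 (ii) at kit level, for kits of a §4 datum**: abc-iut-w4-d054's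
`thetaBridgeAlgorithm_isModelConjugate` — the output of the algorithm admits "isomorphisms `𝔇_> ⥲ †𝔇_>`,
`𝔇_⋇ ⥲ †𝔇_{T^⋇}`, conjugation by which maps `φ^Θ_⋇ ↦ †φ^Θ_⋇`" (the kit's `thetaPolyBad` at bad places, the full
poly-isomorphism at good places) — with its one hypothesis, the bi-invariance of `φ^Θ_{v_j}` under
automorphisms of `𝒟_v` (Ex 4.4 (ii) "composing with arbitrary isomorphisms"), DISCHARGED by
`KitCore.thetaPolyBad_biSaturated`. ([IUTchI] Prop 6.7 p.167) [claim: Mochizuki2012, status: disputed] -/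
theorem thetaBridgeAlgorithm_isModelConjugate (hM : c.ThetaAgrees M) (hl : Odd 𝔡.l) :
    PMBaseKit.DThetaPMBridge.ThetaBridgeAlgorithm M
      (fun D => ∃ (e : D.J ≃ Fin ((𝔡.l - 1) / 2)) (κ : ∀ j, (PMBaseKit.DStrip.model K).Iso (D.capsule j))
          (δ : (PMBaseKit.DStrip.model K).Iso D.codomain),
        (∀ (j : D.J) (v : K.V) (hv : v ∈ K.bad), D.poly j v =
            {h | ∃ g ∈ M.thetaPolyBad (e j) v hv, h = (κ j v).inv ≫ g ≫ (δ v).hom}) ∧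
        (∀ (j : D.J) (v : K.V), v ∉ K.bad → D.poly j v =
            {h | ∃ g : K.model v ≅ K.model v, h = (κ j v).inv ≫ g.hom ≫ (δ v).hom}))
      hl :=
  PMBaseKit.DThetaPMBridge.thetaBridgeAlgorithm_isModelConjugate M hl
    fun j v hv a b _ hg => thetaPolyBad_biSaturated hM v hv j a b hg

/-- **[IUTchI] Prop 6.7 ⇒ Def 4.6 (ii) in abc-iut-L5-t3's shape (sub-DAG row P67-L05)**: for a base kit that
core-agrees with a §4 datum `𝔡` and every `𝒟-Θ^±`-bridge `B`, the output `†φ^Θ_⋇ : †𝔇_{T^⋇} → †𝔇_>` of the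
algorithm satisfies the `isModel` clause of `BaseThetaDatum.DThetaBridge` (`BaseHodgeTheaters.lean`, Def 4.6
(ii) p. 111: "there exist isomorphisms `𝔇_> ⥲ †𝔇_>`, `𝔇_⋇ ⥲ †𝔇_J`, conjugation by which maps `φ^Θ_⋇ ↦ †φ^Θ_⋇`")
FIELD FOR FIELD — a bijection `ι : 𝔽_l^⋇ ⥲ T^⋇`, isomorphisms `κ_j : 𝒟_v ⥲ †𝒟_{ι(j),v}`, `δ : 𝒟_v ⥲ †𝒟_{>,v}`
(`v` a place of the kit), with `†φ^Θ_{ι(j),v}` EXACTLY the conjugate `κ_j⁻¹ ∘ φ^Θ_{v_j} ∘ δ` of abc-iut-L5-t3's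
model poly-morphism `φ^Θ_{v_j} = modelThetaBridge j v` of Example 4.4 (iv) (evaluation sections of label
`j` at bad `v`, the full poly-isomorphism at good `v`), read in the kit through the dictionary.
([IUTchI] Prop 6.7 p.167) [claim: Mochizuki2012, status: disputed] -/
theorem thetaBridgeData_isModel (hM : c.ThetaAgrees M) (hl : Odd 𝔡.l) (B : K.DThetaPMBridge) :
    ∃ (ι : FlStar 𝔡.l ≃ (B.thetaBridgeData M hl).J)
      (κ : ∀ j, (PMBaseKit.DStrip.model K).Iso ((B.thetaBridgeData M hl).capsule (ι j)))
      (δ : (PMBaseKit.DStrip.model K).Iso (B.thetaBridgeData M hl).codomain),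
      ∀ (j : FlStar 𝔡.l) (x : K.V), (B.thetaBridgeData M hl).poly (ι j) x =
        {h | ∃ f ∈ 𝔡.modelThetaBridge j (c.e x),
          h = (κ j x).inv ≫ ((c.ambModel x).inv ≫ (c.amb x).map f ≫ (c.ambModel x).hom) ≫ (δ x).hom} := by
  obtain ⟨e₀, κ, δ, hbad, hgood⟩ := thetaBridgeAlgorithm_isModelConjugate hM hl B
  let fe : Fin (lStar 𝔡.l) ≃ FlStar 𝔡.l :=
    Equiv.ofBijective (FlStar.ofFin 𝔡.l) (FlStar.ofFin_bijective 𝔡.l 𝔡.l_ne_two)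
  let ι : FlStar 𝔡.l ≃ (B.thetaBridgeData M hl).J := (e₀.trans fe).symm
  have hj : ∀ j : FlStar 𝔡.l, FlStar.ofFin 𝔡.l (e₀ (ι j)) = j := fun j => by
    change fe (e₀ (e₀.symm (fe.symm j))) = j
    rw [Equiv.apply_symm_apply, Equiv.apply_symm_apply]
  refine ⟨ι, fun j => κ (ι j), δ, fun j x => ?_⟩
  by_cases hx : x ∈ K.bad
  · rw [hbad (ι j) x hx]
    ext h
    constructor
    · rintro ⟨g, hg, rfl⟩
      rw [hM x hx] at hg
      obtain ⟨f, hf, rfl⟩ := hg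
      rw [hj] at hf
      exact ⟨f, hf, rfl⟩
    · rintro ⟨f, hf, rfl⟩
      refine ⟨(c.ambModel x).inv ≫ (c.amb x).map f ≫ (c.ambModel x).hom, ?_, rfl⟩
      rw [hM x hx]
      refine ⟨f, ?_, rfl⟩
      rw [hj]
      exact hf
  · rw [hgood (ι j) x hx]
    have hfull := c.transport_phiThetaAt_of_not_bad x hx j
    ext h
    constructor
    · rintro ⟨g, rfl⟩
      have hg : g.hom ∈ {g : K.model x ⟶ K.model x |
          ∃ f ∈ 𝔡.phiThetaAt j (c.e x) (𝔡.D (c.e x)) (𝔡.D (c.e x)),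
            g = (c.ambModel x).inv ≫ (c.amb x).map f ≫ (c.ambModel x).hom} := by
        rw [hfull]; exact ⟨g, rfl⟩
      obtain ⟨f, hf, hgf⟩ := hg
      exact ⟨f, hf, by rw [← hgf]⟩
    · rintro ⟨f, hf, rfl⟩
      have hg : (c.ambModel x).inv ≫ (c.amb x).map f ≫ (c.ambModel x).hom ∈
          {g : K.model x ⟶ K.model x | ∃ θ : K.model x ≅ K.model x, g = θ.hom} := by
        rw [← hfull]; exact ⟨f, hf, rfl⟩
      obtain ⟨θ, hθ⟩ := hg
      exact ⟨θ, by rw [hθ]⟩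

/-- **[IUTchI] Prop 4.8 (ii) on the outputs of Prop 6.7, for kits of a §4 datum**: "the set of isomorphisms
between two `𝒟-Θ`-bridges is of cardinality one" — between the `𝒟-Θ`-bridge data produced from any two
`𝒟-Θ^±`-bridges there is EXACTLY ONE Def-4.6 (ii) morphism (existence: abc-iut-w5-d228's
`thetaBridgeData_hom_nonempty`; uniqueness: `KitCore.thetaBridgeData_hom_subsingleton`, from the derived
label-rigidity law). ([IUTchI] Prop 4.8 (ii) p.115) [claim: Mochizuki2012, status: disputed] -/
theorem card_thetaBridgeData_hom (hM : c.ThetaAgrees M) (hl : Odd 𝔡.l) {x : K.V} (hx : x ∈ K.bad)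
    (B₁ B₂ : K.DThetaPMBridge) :
    Nat.card (PMBaseKit.DThetaBridgeData.Hom (B₁.thetaBridgeData M hl) (B₂.thetaBridgeData M hl)) = 1 := by
  haveI := thetaBridgeData_hom_subsingleton hM hl hx B₁ B₂
  obtain ⟨φ⟩ := PMBaseKit.DThetaPMBridge.thetaBridgeData_hom_nonempty M hl B₁ B₂
  haveI : Unique (PMBaseKit.DThetaBridgeData.Hom (B₁.thetaBridgeData M hl) (B₂.thetaBridgeData M hl)) :=
    uniqueOfSubsingleton φ
  exact Nat.card_unique

end BaseThetaDatum.KitCore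

end Literature.IUT.HodgeTheaters
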